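import Mathlib
import Summits.AtomisticToContinuum.FouriersLaw.Theorems.EmbeddedDrudeMourreDrudeDissolutionSupAlgebra
import HarnessLib

/-!
# The `η⁻²` sup bound in the curve regime: the algebra
(crux `EmbeddedDrudeMourre.DrudeDissolution`, item stmt-AtomisticToContinuum-12593; `--supports` file for the
registered sub-goal `supBound_curve_algebra` of stub B1b″ `stub_excursionSecondDifference` of line
`kinetic-polymer-gas-on-the-time-axis`; closes nothing; lead c13 (process B), 2026-08-17)

WHAT. The pointwise flux bound `flux_pointwise_bound` controls `|L(LG)(p)|` by
`B = 9g₂/m² + 189g₁n/m³ + 63g₀t/m³ + 1359g₀n²/m⁴`. In the CURVE REGIME of the sup-norm route the local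
data at `p` are (with `x = |S₁|`, `y = |S₂|`, `z = |A|`, `μ = z²x²+z²y²+x²y²`):
floor `m = √(cμ)` (`0 < c ≤ 1`), weight-times-cutoff sizes
`g₀ = C x²y²`, `g₁ = C(xy(x+y) + a x²y²/η)`, `g₂ = C(x²+y² + 2a·xy(x+y)/η + b·x²y²/η²)`
(`a/η`, `b/η²` the cutoff derivative bounds), `n = Cₙ(x+y+z)`, `t = Cₜ`, and the support conditions
`η² ≤ x²+y²`, `η² ≤ x²+z²`, `η² ≤ y²+z²`. THEN `B ≤ K/η²` with the explicit
`K = 9C(3+6a+b)/c + 189·C·Cₙ(9+3a)/(c√c) + 126·C·Cₜ/(c√c) + 12231·C·Cₙ²/c²`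
(`supBound_curve_algebra`, from `supAlgebra_powerCounting`).

WHY (role). This is the arithmetic heart of item (C6) of the remaining concrete work for B1b″: once the
structure bounds of `Ω`, `W` and the floor supply the local data in this shape, the sup hypothesis of
`cube_secondDiff_of_cutoffFamily` holds with this `K`.
-/

noncomputable section

namespace Summit.AtomisticToContinuum.FouriersLaw.Theorems.DrudeDissolution.KineticPolymerGasOnTheTimeAxis

/-- **The curve-regime algebra (registered sub-goal `supBound_curve_algebra` of stub B1b″).** See the
module docstring. [folklore] -/
theorem supBound_curve_algebra :
    ∀ (x y z η c C a b Cn Ct : ℝ), 0 ≤ x → 0 ≤ y → 0 ≤ z → 0 < η → η ≤ 1 → 0 < c → c ≤ 1 →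
      0 ≤ C → 0 ≤ a → 0 ≤ b → 0 ≤ Cn → 0 ≤ Ct →
      η ^ 2 ≤ x ^ 2 + y ^ 2 → η ^ 2 ≤ x ^ 2 + z ^ 2 → η ^ 2 ≤ y ^ 2 + z ^ 2 →
      9 * (C * (x ^ 2 + y ^ 2 + 2 * a * (x * y * (x + y)) / η + b * (x ^ 2 * y ^ 2) / η ^ 2)) /
            Real.sqrt (c * (z ^ 2 * x ^ 2 + z ^ 2 * y ^ 2 + x ^ 2 * y ^ 2)) ^ 2 +
          189 * (C * (x * y * (x + y) + a * (x ^ 2 * y ^ 2) / η)) * (Cn * (x + y + z)) /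
            Real.sqrt (c * (z ^ 2 * x ^ 2 + z ^ 2 * y ^ 2 + x ^ 2 * y ^ 2)) ^ 3 +
          63 * (C * (x ^ 2 * y ^ 2)) * Ct / Real.sqrt (c * (z ^ 2 * x ^ 2 + z ^ 2 * y ^ 2 + x ^ 2 * y ^ 2)) ^ 3 +
          1359 * (C * (x ^ 2 * y ^ 2)) * (Cn * (x + y + z)) ^ 2 /
            Real.sqrt (c * (z ^ 2 * x ^ 2 + z ^ 2 * y ^ 2 + x ^ 2 * y ^ 2)) ^ 4 ≤
        (9 * C * (3 + 6 * a + b) / c + 189 * C * Cn * (9 + 3 * a) / (c * Real.sqrt c) +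
          126 * C * Ct / (c * Real.sqrt c) + 12231 * C * Cn ^ 2 / c ^ 2) / η ^ 2 := by
  intro x y z η c C a b Cn Ct hx hy hz hη hη1 hc hc1 hC ha hb hCn hCt hxy hxz hyz
  obtain ⟨hμ, i1, i2, i3, i4, i5, i6, i7⟩ := supAlgebra_powerCounting x y z η hx hy hz hη hη1 hxy hxz hyz
  set μ := z ^ 2 * x ^ 2 + z ^ 2 * y ^ 2 + x ^ 2 * y ^ 2 with hμdef
  have hη2 : 0 < η ^ 2 := pow_pos hη 2
  set s := Real.sqrt μ with hs
  have hs0 : 0 < s := Real.sqrt_pos.2 hμ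
  set r := Real.sqrt c with hr
  have hr0 : 0 < r := Real.sqrt_pos.2 hc
  have hr2 : r ^ 2 = c := Real.sq_sqrt hc.le
  -- `√(cμ) = r s`, and its powers
  have hsq : Real.sqrt (c * μ) = r * s := by rw [hr, hs, Real.sqrt_mul hc.le]
  have hm2 : Real.sqrt (c * μ) ^ 2 = c * μ := Real.sq_sqrt (by positivity)
  have hm3 : Real.sqrt (c * μ) ^ 3 = c * r * s ^ 3 := by rw [hsq]; rw [← hr2]; ring
  have hm4 : Real.sqrt (c * μ) ^ 4 = c ^ 2 * μ ^ 2 := by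
    rw [show (4 : ℕ) = 2 * 2 by norm_num, pow_mul, hm2]; ring
  have hs2 : s ^ 2 = μ := Real.sq_sqrt hμ.le
  rw [hm2, hm3, hm4]
  -- the four terms, one by one
  have hxyn : 0 ≤ x * y := mul_nonneg hx hy
  -- T1 ≤ 9C(3+6a+b)/(c η²)
  have T1 : 9 * (C * (x ^ 2 + y ^ 2 + 2 * a * (x * y * (x + y)) / η + b * (x ^ 2 * y ^ 2) / η ^ 2)) / (c * μ) ≤
      9 * C * (3 + 6 * a + b) / c / η ^ 2 := by
    have e : 9 * (C * (x ^ 2 + y ^ 2 + 2 * a * (x * y * (x + y)) / η + b * (x ^ 2 * y ^ 2) / η ^ 2)) / (c * μ) =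
        9 * C / c * ((x ^ 2 + y ^ 2) / μ + 2 * a * (x * y * (x + y) / (η * μ)) + b * (x ^ 2 * y ^ 2 / (η ^ 2 * μ))) := by
      field_simp
    rw [e]
    have h : (x ^ 2 + y ^ 2) / μ + 2 * a * (x * y * (x + y) / (η * μ)) + b * (x ^ 2 * y ^ 2 / (η ^ 2 * μ)) ≤
        3 / η ^ 2 + 2 * a * (3 / η ^ 2) + b * (1 / η ^ 2) := by gcongr
    calc 9 * C / c * ((x ^ 2 + y ^ 2) / μ + 2 * a * (x * y * (x + y) / (η * μ)) + b * (x ^ 2 * y ^ 2 / (η ^ 2 * μ)))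
        ≤ 9 * C / c * (3 / η ^ 2 + 2 * a * (3 / η ^ 2) + b * (1 / η ^ 2)) := by gcongr
      _ = 9 * C * (3 + 6 * a + b) / c / η ^ 2 := by field_simp; ring
  -- T2 ≤ 189 C Cn (9+3a)/(c r η²)
  have T2 : 189 * (C * (x * y * (x + y) + a * (x ^ 2 * y ^ 2) / η)) * (Cn * (x + y + z)) / (c * r * s ^ 3) ≤
      189 * C * Cn * (9 + 3 * a) / (c * r) / η ^ 2 := by
    have e : 189 * (C * (x * y * (x + y) + a * (x ^ 2 * y ^ 2) / η)) * (Cn * (x + y + z)) / (c * r * s ^ 3) =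
        189 * C * Cn / (c * r) * (x * y * (x + y) * (x + y + z) / s ^ 3 + a * (x ^ 2 * y ^ 2 * (x + y + z) / (η * s ^ 3))) := by
      field_simp
    rw [e]
    have h : x * y * (x + y) * (x + y + z) / s ^ 3 + a * (x ^ 2 * y ^ 2 * (x + y + z) / (η * s ^ 3)) ≤
        9 / η ^ 2 + a * (3 / η ^ 2) := by gcongr
    calc 189 * C * Cn / (c * r) * (x * y * (x + y) * (x + y + z) / s ^ 3 + a * (x ^ 2 * y ^ 2 * (x + y + z) / (η * s ^ 3)))
        ≤ 189 * C * Cn / (c * r) * (9 / η ^ 2 + a * (3 / η ^ 2)) := by gcongr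
      _ = 189 * C * Cn * (9 + 3 * a) / (c * r) / η ^ 2 := by field_simp
  -- T3 ≤ 126 C Ct/(c r η²)
  have T3 : 63 * (C * (x ^ 2 * y ^ 2)) * Ct / (c * r * s ^ 3) ≤ 126 * C * Ct / (c * r) / η ^ 2 := by
    have e : 63 * (C * (x ^ 2 * y ^ 2)) * Ct / (c * r * s ^ 3) = 63 * C * Ct / (c * r) * (x ^ 2 * y ^ 2 / s ^ 3) := by
      field_simp
    rw [e]
    calc 63 * C * Ct / (c * r) * (x ^ 2 * y ^ 2 / s ^ 3) ≤ 63 * C * Ct / (c * r) * (2 / η ^ 2) := by gcongr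
      _ = 126 * C * Ct / (c * r) / η ^ 2 := by field_simp; ring
  -- T4 ≤ 12231 C Cn²/(c² η²)
  have T4 : 1359 * (C * (x ^ 2 * y ^ 2)) * (Cn * (x + y + z)) ^ 2 / (c ^ 2 * μ ^ 2) ≤
      12231 * C * Cn ^ 2 / c ^ 2 / η ^ 2 := by
    have e : 1359 * (C * (x ^ 2 * y ^ 2)) * (Cn * (x + y + z)) ^ 2 / (c ^ 2 * μ ^ 2) =
        1359 * C * Cn ^ 2 / c ^ 2 * (x ^ 2 * y ^ 2 * (x + y + z) ^ 2 / μ ^ 2) := by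
      field_simp
    rw [e]
    calc 1359 * C * Cn ^ 2 / c ^ 2 * (x ^ 2 * y ^ 2 * (x + y + z) ^ 2 / μ ^ 2)
        ≤ 1359 * C * Cn ^ 2 / c ^ 2 * (9 / η ^ 2) := by gcongr
      _ = 12231 * C * Cn ^ 2 / c ^ 2 / η ^ 2 := by field_simp; ring
  have htot := add_le_add (add_le_add (add_le_add T1 T2) T3) T4
  refine htot.trans (le_of_eq ?_)
  rw [hr]
  field_simp

end Summit.AtomisticToContinuum.FouriersLaw.Theorems.DrudeDissolution.KineticPolymerGasOnTheTimeAxis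

end
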